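import Summits.QuantumFields.YangMills.Theorems.BalabanUVNodesN06AtRecord11ObligationsPins4
import Literature.MathematicalPhysics.QuantumFieldTheory.Balaban1983to89.B9RWSums344InputGp

/-!
# BalabanUVNodes ∕ N06 ([B9], `Dag.B9_main`) — OBLIGATIONS OF THE STAGE-11 CERTIFICATE KNIT AT THE RECORD, XI-g: `t310` AND `t37` AT THE ALL-BLOCKS PINS WITH EVERY MEMBER OF
# THEOREMS 3.3 ∕ 3.1 PROVED INSIDE THE LEAVES EXCEPT THE TWO-SIDED L² LINE (3.46)₄ (seat n06-k's `B9RWSums344Input(Gp)` over `…346Lap` ∕ `…343Holder(Gp)`)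

Track A of `YM-PLAN.md` (cell `pub-ymgap`, HUMAN RULING D-0062), node **N06** = [Balaban1985BackgroundPropagators] Thms 3.1–3.15; seat
`pub-ymgap-dag-n06-d` gen 3 = dag-lead N06-ASSIGNMENT v1 (P3) «THE KNIT AT THE RECORD».  Companion of `…ObligationsPins4` ∕ `…Pins5` ∕ `…Pins6` (per-row lemmas at `ops : OpsY N θ₃ M⋆`).

THE POINT.  `…Pins6.t310_of_allPin_lap` ∕ `t37_of_allPin_lap` (rows 19 ∕ 18 at the all-blocks pins; (3.42), (3.47), (3.46)₀₋₃,₅, (3.43) members proved on n06-k's p474790 ∕ p475516 ∕ p477383)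
still displayed the INPUT-side Hölder members (3.44), (3.45) of G(U) ∕ G′(U).  Seat n06-k's `B9RWSums344Input.thm310Printed_allPin_inputHolder` (p478647) and its G′ twin
`B9RWSums344InputGp.thm37Printed_allPin_inputHolder` PROVE them inside the leaves, in n06-b's block-norm calculus `B11SectG.HasMaj` with an input block-norm LETTER `bH x ε` (the size
‖λ‖^{ξ′}_ε + |λ| on Δ̃(y′), co-read by `InputReads`): by (3.106) ∇_UG∇*_U = ∇_UG₀∇*_U + (∇_UG)(R∇*_U) (resp. (3.88) for G′) — head legs (`InputLegs310` ∕ `InputLegs37`, Cor. 3.6's (3.44)∕(3.45)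
for h_□G_□h_□, POSITED) plus ONE composition of the pin's ∇_UG majorant ∕ the probe majorant with the factors' INPUT bounds R_a∇*_U (`FactorsInput310` ∕ `FactorsInput37`, p. 413 *"additional
power of L^jη"*, POSITED), p. 398's transfer and [4] (2.61) — so that each half of rows 18–19 displays ONE line: the two-sided L² member (3.46)₄ ‖h∇_UG∇*_UJ‖ (its printed bound is
L²-theoretic; no sup majorant in print, cell GAPS G-B9-02∕07).

WHAT THIS MODULE DOES (kernel bookkeeping; 0 `def`, 0 `sorry`, standard axioms; COUNT-NEUTRAL, `--supports` K1′ `StabilityBAtRecordR12e`), at `I := MemberY`, `geo9Y`, `bg9Y (M_N ℂ) SU(N)`,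
`c35Y`: ★ `t310_of_allPin_input`, ★ `t37_of_allPin_input` — `B9.Thm310Printed … (fun x => (ops x).E310)` ∕ `B9.Thm37Printed … (fun x => (ops x).E37)` at the all-blocks pins from the inputs of
`…Pins6.t310∕t37_of_allPin_lap` PLUS the input letter `bH`, the input-leg supports `SI` with count `NI`, the constants `BI θI BI2` with `hBε` ∕ `hBεβ` (n06-k's `inputConst44∕45` against the
pin's `Bε Bεβ`), the co-reading `hIR`, `hαF1 : αF ≤ 1` (for `α·δ ≤ δ` at the pin), and ONE operator-level package `h36H` = Hölder legs ∧ probe-read factors (resp. V-terms) ∧ Laplacian legs ∧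
input legs ∧ input-read factors at `h36`'s thresholds `M₁ a₁` and rate `δ₀` (n06-k's parameters `d₁ := d`, `δ₁ := δ₀`, `α₁ := α` as in Pins5∕6) — with `hrest` = the line n = 4 ONLY.

HONEST FRAMING.  Kernel bookkeeping at pinned readings over displayed hypothesis schemas of printed ∕ located shape; nothing of [B9] is proved for Bałaban's operators; N06 is
NOT discharged.  One finite four-torus programme at fixed `ε` — NOT ℝ⁴, NOT OS, NOT a mass gap, NOT Clay.  No `def`.
-/





noncomputable section

namespace Summit.QuantumFields.YangMills.BalabanUVNodes.N06AtRecord11ObligationsPins7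

open Literature.MathematicalPhysics.QuantumFieldTheory.Balaban1983to89
open Literature.MathematicalPhysics.QuantumFieldTheory.Balaban1983to89.Node00
open Literature.MathematicalPhysics.QuantumFieldTheory.Balaban1983to89.B9PinMembersKLevelV1 (MemberY geo9Y bg9Y)
open Literature.MathematicalPhysics.QuantumFieldTheory.Balaban1983to89.B9PinGeometryKLevelV1 (c35Y c35Y_pos)
open Literature.MathematicalPhysics.QuantumFieldTheory.Balaban1983to89.B7Prop2SpecialUnitary (specialUnitaryUnits)
open Literature.MathematicalPhysics.QuantumFieldTheory.Balaban1983to89.B9Thm34Ext (toB6)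
open Literature.MathematicalPhysics.QuantumFieldTheory.Balaban1983to89.B6RandomWalk (Ineq261)
open Literature.MathematicalPhysics.QuantumFieldTheory.Balaban1983to89.B9Thm37Whole (Ops Sizes StaticOK Local342 Identities const37)
open Literature.MathematicalPhysics.QuantumFieldTheory.Balaban1983to89.B9Cor38Whole
open Literature.MathematicalPhysics.QuantumFieldTheory.Balaban1983to89.B9Thm37GlueCor36 (CoRealizes)
open Literature.MathematicalPhysics.QuantumFieldTheory.Balaban1983to89.B9Thm37Glue (IsTransposePair)
open Literature.MathematicalPhysics.QuantumFieldTheory.Balaban1983to89.B9Thm310Whole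
open Literature.MathematicalPhysics.QuantumFieldTheory.Balaban1983to89.B9RWSums343to347Whole
open Literature.MathematicalPhysics.QuantumFieldTheory.Balaban1983to89.B9RWSums346Schur (L2Reads thm310Printed_allPin_schur thm37Printed_allPin_schur)
open Literature.MathematicalPhysics.QuantumFieldTheory.Balaban1983to89.B9GeoLemma21KLevelV1 (geo9Y_dist_comm geo9Y_len_pos)
open Literature.MathematicalPhysics.QuantumFieldTheory.Balaban1983to89.B9GeoNormsKLevelV1 (geo9K_dist_nonneg)
open Summit.QuantumFields.YangMills.BalabanUVNodes.N06AtRecord11Obligations (const37_nonneg)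
open scoped Matrix.Norms.L2Operator
open Literature.MathematicalPhysics.QuantumFieldTheory.Balaban1983to89.B9RWSums343Holder
  (HolderProbes H1Reads HolderLegs310 FactorsHolder310 holderConst)
open Literature.MathematicalPhysics.QuantumFieldTheory.Balaban1983to89.B9RWSums343HolderGp (HolderLegs37 HolderV37)
open Literature.MathematicalPhysics.QuantumFieldTheory.Balaban1983to89.B9RWSums346Lap (LapLegs310 LapLegs37 lapConst)
open Literature.MathematicalPhysics.QuantumFieldTheory.Balaban1983to89.B9RWSums344InputGp (InputLegs37 FactorsInput37 thm37Printed_allPin_inputHolder)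
open Literature.MathematicalPhysics.QuantumFieldTheory.Balaban1983to89.B9RWSums344Input (InputReads InputLegs310 FactorsInput310 inputConst44 inputConst45 thm310Printed_allPin_inputHolder)
open Literature.MathematicalPhysics.QuantumFieldTheory.Balaban1983to89.B11SectG (BlockNorm)

variable {N : ℕ} (θ₃ : Stage3Params) (Mstar : ℕ) (ops : OpsY N θ₃ Mstar)

/-- ★ **`t310` AT THE ALL-BLOCKS PIN, EVERYTHING BUT THE LINE (3.46)₄ PROVED** `(ops x).E310 = W310OfOps (𝔬 x) (rd x) (ConvAll3107 (𝔬 x) (R x) (H x) C δ (ops x).GA B₁ δ₁ …)` (C = `const37 …`,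
δ = (1−2α)δ₀): n06-k's inputs give Theorem 3.10 at `W310OfOps … (Conv3107 …)` (`thm310Printed_of_local3107`), and `thm310Printed_allPin_inputHolder` strengthens the predicate from the
co-readings of `(ops x).GA` (sup ∕ weighted ∕ L² incl. `hl3 hl5` ∕ Hölder-through-probes `hH1` ∕ input `hIR` through the letter `bH`), the symmetry of G(U), the transpose pair and the transpose
letter `hadjL`, `Facts347` (M ≧ M_g; at rate δ₀ for M ≧ M_F), Cor. 3.6's Hölder legs, probe-read factors, Laplacian legs, input legs and input-read factors (`h36H`), the constants' relations
(`hBβ`, `hB5`, `hBε`, `hBεβ`) and the residual (3.46)₄ under the provisos — displayed.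
[cite: Balaban1985BackgroundPropagators, Thm 3.10 (3.105)–(3.108) pp.413–416, Thm 3.10 ⇒ Thm 3.3 p.416, Cor. 3.6 p.408, (3.40) p.397, (3.42)–(3.47) pp.397–398; Balaban1984PropagatorsII, Lemma 2.1 (2.60)–(2.61) p.234] -/
theorem t310_of_allPin_input [∀ x : MemberY θ₃.d₆ θ₃.ℓ₆ θ₃.hd' θ₃.hL' θ₃.b₀ θ₃.b₁ Mstar, Fintype (geo9Y x).Site] [∀ x : MemberY θ₃.d₆ θ₃.ℓ₆ θ₃.hd' θ₃.hL' θ₃.b₀ θ₃.b₁ Mstar, DecidableEq (geo9Y x).Site]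
    {X Y ι A PX PY : MemberY θ₃.d₆ θ₃.ℓ₆ θ₃.hd' θ₃.hL' θ₃.b₀ θ₃.b₁ Mstar → Type} [∀ x, Fintype (X x)] [∀ x, DecidableEq (X x)] [∀ x, Fintype (Y x)]
    [∀ x, DecidableEq (Y x)] [∀ x, Fintype (ι x)] [∀ x, Fintype (A x)] [∀ x, Fintype (PX x)] [∀ x, DecidableEq (PX x)] [∀ x, Fintype (PY x)] [∀ x, DecidableEq (PY x)]
    (𝔬 : ∀ x : MemberY θ₃.d₆ θ₃.ℓ₆ θ₃.hd' θ₃.hL' θ₃.b₀ θ₃.b₁ Mstar, Ops310 (geo9Y x) (bg9Y (Matrix (Fin N) (Fin N) ℂ) (specialUnitaryUnits (Fin N)) x) (X x) (Y x) (ι x) (A x))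
    (rd : ∀ x : MemberY θ₃.d₆ θ₃.ℓ₆ θ₃.hd' θ₃.hL' θ₃.b₀ θ₃.b₁ Mstar, WalkReading310 (geo9Y x) (bg9Y (Matrix (Fin N) (Fin N) ℂ) (specialUnitaryUnits (Fin N)) x) (X x) (ι x) (A x))
    (𝔭 : ∀ x : MemberY θ₃.d₆ θ₃.ℓ₆ θ₃.hd' θ₃.hL' θ₃.b₀ θ₃.b₁ Mstar, HolderProbes (geo9Y x) (bg9Y (Matrix (Fin N) (Fin N) ℂ) (specialUnitaryUnits (Fin N)) x) (X x) (Y x) (PX x) (PY x))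
    (SH SL SI : ∀ x : MemberY θ₃.d₆ θ₃.ℓ₆ θ₃.hd' θ₃.hL' θ₃.b₀ θ₃.b₁ Mstar, ι x → Finset (geo9Y x).Site) (Bl θH BI θI : ℝ → ℝ) (BI2 : ℝ → ℝ → ℝ) (NH NL BL MF NI : ℝ) (dL : ℕ)
    (R : MemberY θ₃.d₆ θ₃.ℓ₆ θ₃.hd' θ₃.hL' θ₃.b₀ θ₃.b₁ Mstar → ℝ) (H : MemberY θ₃.d₆ θ₃.ℓ₆ θ₃.hd' θ₃.hL' θ₃.b₀ θ₃.b₁ Mstar → Prop) (κ : MemberY θ₃.d₆ θ₃.ℓ₆ θ₃.hd' θ₃.hL' θ₃.b₀ θ₃.b₁ Mstar → Sizes310)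
    (bH : ∀ x : MemberY θ₃.d₆ θ₃.ℓ₆ θ₃.hd' θ₃.hL' θ₃.b₀ θ₃.b₁ Mstar, ℝ → BlockNorm (toB6 (geo9Y x) (R x) (H x)) (Y x → ℝ))
    (d : ℕ) (α ρ Nc N' NF Cℓ K θ₀ B₀ δ₀ a₁ M₁ ML : ℝ)
    (hα : 0 ≤ α) (hα2 : α ≤ 1 / 2) (hN : 0 ≤ Nc) (hN' : 0 ≤ N') (hNF : 0 ≤ NF) (hCℓ : 1 ≤ Cℓ) (hK : 0 ≤ K) (hθ₀ : 0 ≤ θ₀) (hB₀ : 0 < B₀)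
    (hδ₀ : 0 < δ₀) (ha₁ : 0 < a₁) (hM₁ : 0 < M₁) (hNH : 0 ≤ NH) (hNL : 0 ≤ NL) (hBL : 0 ≤ BL) (hNI : 0 ≤ NI)
    (hst : ∀ x, StaticOK310 (𝔬 x) ρ Nc N' NF Cℓ (κ x)) (hκ : ∀ x, (κ x).Bounded K)
    (hrd : ∀ x, (rd x).OK (𝔬 x).blk) (hloc : ∀ x, Locality310 (𝔬 x) (rd x))
    (h261 : ∀ x : MemberY θ₃.d₆ θ₃.ℓ₆ θ₃.hd' θ₃.hL' θ₃.b₀ θ₃.b₁ Mstar, ML ≤ (geo9Y x).M → Ineq261 d (toB6 (geo9Y x) (R x) (H x)) δ₀ α)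
    (h36 : ∀ x : MemberY θ₃.d₆ θ₃.ℓ₆ θ₃.hd' θ₃.hL' θ₃.b₀ θ₃.b₁ Mstar, M₁ ≤ (geo9Y x).M → ∀ α₀ : ℝ, 0 < α₀ → c35Y * (geo9Y x).M * α₀ ≤ a₁ →
      ∀ U : (bg9Y (Matrix (Fin N) (Fin N) ℂ) (specialUnitaryUnits (Fin N)) x).Cfg, (bg9Y (Matrix (Fin N) (Fin N) ℂ) (specialUnitaryUnits (Fin N)) x).Reg335 c35Y α₀ U →
        Local342G (𝔬 x) (R x) (H x) B₀ δ₀ U ∧ Factors389 (𝔬 x) (R x) (H x) θ₀ δ₀ U ∧ Identities310 (𝔬 x) (R x) (H x) U)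
    (h36H : ∀ x : MemberY θ₃.d₆ θ₃.ℓ₆ θ₃.hd' θ₃.hL' θ₃.b₀ θ₃.b₁ Mstar, M₁ ≤ (geo9Y x).M → ∀ α₀ : ℝ, 0 < α₀ → c35Y * (geo9Y x).M * α₀ ≤ a₁ →
      ∀ U : (bg9Y (Matrix (Fin N) (Fin N) ℂ) (specialUnitaryUnits (Fin N)) x).Cfg, (bg9Y (Matrix (Fin N) (Fin N) ℂ) (specialUnitaryUnits (Fin N)) x).Reg335 c35Y α₀ U →
        HolderLegs310 (𝔬 x) (𝔭 x) (R x) (H x) (SH x) Bl δ₀ U ∧ FactorsHolder310 (𝔬 x) (𝔭 x) (R x) (H x) θH δ₀ U ∧ LapLegs310 (𝔬 x) (R x) (H x) (SL x) BL δ₀ U ∧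
          InputLegs310 (𝔬 x) (𝔭 x) (R x) (H x) (bH x) (SI x) BI BI2 δ₀ U ∧ FactorsInput310 (𝔬 x) (R x) (H x) (bH x) θI δ₀ U)
    (hcntH : ∀ (x : MemberY θ₃.d₆ θ₃.ℓ₆ θ₃.hd' θ₃.hL' θ₃.b₀ θ₃.b₁ Mstar) (a : (geo9Y x).Site), (∑ q, if a ∈ SH x q then (1 : ℝ) else 0) ≤ NH)
    (hcntL : ∀ (x : MemberY θ₃.d₆ θ₃.ℓ₆ θ₃.hd' θ₃.hL' θ₃.b₀ θ₃.b₁ Mstar) (a : (geo9Y x).Site), (∑ q, if a ∈ SL x q then (1 : ℝ) else 0) ≤ NL)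
    (hcntI : ∀ (x : MemberY θ₃.d₆ θ₃.ℓ₆ θ₃.hd' θ₃.hL' θ₃.b₀ θ₃.b₁ Mstar) (a : (geo9Y x).Site), (∑ q, if a ∈ SI x q then (1 : ℝ) else 0) ≤ NI)
    (hBl : ∀ β, 0 ≤ β → β < 1 → 0 ≤ Bl β) (hθH : ∀ β, 0 ≤ β → β < 1 → 0 ≤ θH β) (hBI : ∀ ε, 0 < ε → ε ≤ 1 → 0 ≤ BI ε)
    (hBI2 : ∀ ε β, 0 < ε → ε ≤ 1 → 0 ≤ β → β < 1 → 0 ≤ BI2 ε β) (hθI : ∀ ε, 0 < ε → 0 ≤ θI ε)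
    (ev : ∀ x : MemberY θ₃.d₆ θ₃.ℓ₆ θ₃.hd' θ₃.hL' θ₃.b₀ θ₃.b₁ Mstar, (geo9Y x).Loc → X x → ℝ) (evY : ∀ x : MemberY θ₃.d₆ θ₃.ℓ₆ θ₃.hd' θ₃.hL' θ₃.b₀ θ₃.b₁ Mstar, (geo9Y x).Loc → Y x → ℝ)
    (hco0 : ∀ x U, CoRealizes (ops x).GA 0 U (𝔬 x).blk (𝔬 x).blk (ev x) ((𝔬 x).G U))
    (hco1 : ∀ x U, CoRealizes (ops x).GA 1 U (𝔬 x).blkY (𝔬 x).blk (ev x) ((𝔬 x).D U ∘ₗ (𝔬 x).G U))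
    (hco2 : ∀ x U, CoRealizes (ops x).GA 2 U (𝔬 x).blk (𝔬 x).blkY (evY x) ((𝔬 x).G U ∘ₗ (𝔬 x).Dstar U))
    (hco3 : ∀ x U, CoRealizes (ops x).GA 3 U (𝔬 x).blk (𝔬 x).blk (ev x) ((𝔬 x).Lap U ∘ₗ (𝔬 x).G U))
    (hgl0 : ∀ x U, GlobReads (ops x).GA 0 U (𝔬 x).blk (𝔬 x).blk (ev x) ((𝔬 x).G U))
    (hgl1 : ∀ x U, GlobReads (ops x).GA 1 U (𝔬 x).blkY (𝔬 x).blk (ev x) ((𝔬 x).D U ∘ₗ (𝔬 x).G U))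
    (hgl2 : ∀ x U, GlobReads (ops x).GA 2 U (𝔬 x).blk (𝔬 x).blkY (evY x) ((𝔬 x).G U ∘ₗ (𝔬 x).Dstar U))
    (hgl3 : ∀ x U, GlobReads (ops x).GA 3 U (𝔬 x).blk (𝔬 x).blk (ev x) ((𝔬 x).Lap U ∘ₗ (𝔬 x).G U))
    (hl0 : ∀ x U, L2Reads (R := R x) (H := H x) (ops x).GA 0 U (𝔬 x).blk (𝔬 x).blk (ev x) ((𝔬 x).G U))
    (hl1 : ∀ x U, L2Reads (R := R x) (H := H x) (ops x).GA 1 U (𝔬 x).blkY (𝔬 x).blk (ev x) ((𝔬 x).D U ∘ₗ (𝔬 x).G U))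
    (hl2 : ∀ x U, L2Reads (R := R x) (H := H x) (ops x).GA 2 U (𝔬 x).blk (𝔬 x).blkY (evY x) ((𝔬 x).G U ∘ₗ (𝔬 x).Dstar U))
    (hl3 : ∀ x U, L2Reads (R := R x) (H := H x) (ops x).GA 3 U (𝔬 x).blk (𝔬 x).blk (ev x) ((𝔬 x).Lap U ∘ₗ (𝔬 x).G U))
    (hl5 : ∀ x U, L2Reads (R := R x) (H := H x) (ops x).GA 5 U (𝔬 x).blk (𝔬 x).blk (ev x) ((𝔬 x).G U ∘ₗ (𝔬 x).Lap U))
    (hH1 : ∀ x U, H1Reads (ops x).GA U (𝔭 x) (𝔬 x).blk (𝔬 x).blkY (ev x) (evY x) ((𝔬 x).D U ∘ₗ (𝔬 x).G U) ((𝔬 x).G U ∘ₗ (𝔬 x).Dstar U))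
    (hIR : ∀ x U, InputReads (ops x).GA U (𝔭 x) (bH x) (𝔬 x).blkY (evY x) ((𝔬 x).D U ∘ₗ ((𝔬 x).G U ∘ₗ (𝔬 x).Dstar U)))
    (hsym : ∀ x U, IsTransposePair ((𝔬 x).G U) ((𝔬 x).G U))
    (htr : ∀ x U, IsTransposePair ((𝔬 x).D U ∘ₗ (𝔬 x).G U) ((𝔬 x).G U ∘ₗ (𝔬 x).Dstar U))
    (hadjL : ∀ x U, IsTransposePair ((𝔬 x).Lap U ∘ₗ (𝔬 x).G U) ((𝔬 x).G U ∘ₗ (𝔬 x).Lap U))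
    {dF : ℕ} {αF L₀ B₁ δ₁ Mg Mr ar : ℝ} {Bβ Bε : ℝ → ℝ} {Bεβ : ℝ → ℝ → ℝ}
    (hfacts : ∀ x : MemberY θ₃.d₆ θ₃.ℓ₆ θ₃.hd' θ₃.hL' θ₃.b₀ θ₃.b₁ Mstar, Mg ≤ (geo9Y x).M → Facts347 (geo9Y x) (R x) (H x) dF ((1 - 2 * α) * δ₀) αF L₀)
    (hCB : (const37 d δ₀ α ρ B₀ Nc N' Cℓ K) ≤ B₁) (hCL : (const37 d δ₀ α ρ B₀ Nc N' Cℓ K) * L₀ ≤ B₁) (hδ₁ : δ₁ ≤ (1 - αF) * ((1 - 2 * α) * δ₀)) (hαF : 0 ≤ αF * ((1 - 2 * α) * δ₀))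
    (hαF1 : αF ≤ 1)
    (hCg : (const37 d δ₀ α ρ B₀ Nc N' Cℓ K) * B6.c1 dF ((1 - 2 * α) * δ₀) (1 - αF) * L₀ ^ (4 : ℝ) ≤ B₁) (har : 0 < ar)
    (hBβ : ∀ β, 0 ≤ β → β < 1 → holderConst d δ₀ α NH NF (const37 d δ₀ α ρ B₀ Nc N' Cℓ K) (Bl β) (θH β) ≤ Bβ β)
    (hB5 : Real.sqrt ((const37 d δ₀ α ρ B₀ Nc N' Cℓ K) * lapConst d δ₀ α NL BL L₀) * L₀ ≤ B₁)
    (hfacts₀ : ∀ x : MemberY θ₃.d₆ θ₃.ℓ₆ θ₃.hd' θ₃.hL' θ₃.b₀ θ₃.b₁ Mstar, MF ≤ (geo9Y x).M → Facts347 (geo9Y x) (R x) (H x) dL δ₀ α L₀)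
    (hBε : ∀ ε, 0 < ε → ε ≤ 1 → inputConst44 d δ₀ α NI NF (const37 d δ₀ α ρ B₀ Nc N' Cℓ K) L₀ (BI ε) (θI ε) ≤ Bε ε)
    (hBεβ : ∀ ε β, 0 < ε → ε ≤ 1 → 0 ≤ β → β < 1 →
      inputConst45 d δ₀ α NI NF L₀ (holderConst d δ₀ α NH NF (const37 d δ₀ α ρ B₀ Nc N' Cℓ K) (Bl β) (θH β)) (BI2 ε β) (θI (β + ε)) ≤ Bεβ ε β)
    (hrest : ∀ x : MemberY θ₃.d₆ θ₃.ℓ₆ θ₃.hd' θ₃.hL' θ₃.b₀ θ₃.b₁ Mstar, Mr ≤ (geo9Y x).M → ∀ α₀ : ℝ, 0 < α₀ → (geo9Y x).M * α₀ ≤ ar → ∀ U : (bg9Y (Matrix (Fin N) (Fin N) ℂ) (specialUnitaryUnits (Fin N)) x).Cfg, (bg9Y (Matrix (Fin N) (Fin N) ℂ) (specialUnitaryUnits (Fin N)) x).Reg335 c35Y α₀ U →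
      ∀ (lam : (geo9Y x).Loc) (h : (geo9Y x).Cut) (y y' : (geo9Y x).Site), (geo9Y x).cutIn h y → (geo9Y x).suppIn lam y' →
        (ops x).GA.l2 4 U lam h ≤ B₁ * B9.pref6 ((geo9Y x).len y) 4 * (geo9Y x).cutSup h * Real.exp (-(δ₁ * (geo9Y x).dist y y')) * (geo9Y x).l2Norm lam)
    (hE310 : ∀ x : MemberY θ₃.d₆ θ₃.ℓ₆ θ₃.hd' θ₃.hL' θ₃.b₀ θ₃.b₁ Mstar, (ops x).E310 = W310OfOps (𝔬 x) (rd x) (ConvAll3107 (𝔬 x) (R x) (H x) (const37 d δ₀ α ρ B₀ Nc N' Cℓ K) ((1 - 2 * α) * δ₀) (ops x).GA B₁ δ₁ Bβ Bε Bεβ)) :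
    B9.Thm310Printed c35Y geo9Y (bg9Y (Matrix (Fin N) (Fin N) ℂ) (specialUnitaryUnits (Fin N))) (fun x => (ops x).E310) := by
  have hfun : (fun x => (ops x).E310) = fun x => W310OfOps (𝔬 x) (rd x) (ConvAll3107 (𝔬 x) (R x) (H x) (const37 d δ₀ α ρ B₀ Nc N' Cℓ K) ((1 - 2 * α) * δ₀) (ops x).GA B₁ δ₁ Bβ Bε Bεβ) :=
    funext hE310
  rw [hfun]
  have h310 := thm310Printed_of_local3107 𝔬 rd R H κ d α ρ Nc N' NF Cℓ K θ₀ B₀ δ₀ a₁ M₁ ML c35Y_pos hα hα2 hN hN' hNF hCℓ hK hθ₀ hB₀ hδ₀ ha₁ hM₁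
    hst hκ hrd hloc h261 h36
  have hδnn : 0 ≤ (1 - 2 * α) * δ₀ := by nlinarith
  have hαδ1 : αF * ((1 - 2 * α) * δ₀) ≤ (1 - 2 * α) * δ₀ := by nlinarith
  exact thm310Printed_allPin_inputHolder 𝔭 bH (fun x => (ops x).GA) ev evY κ SH Bl θH d δ₀ α ρ Nc N' NF Cℓ θ₀ NH a₁ M₁ ML SL NL BL MF dL SI NI BI θI BI2 h310
    hco0 hco1 hco2 hco3 hgl0 hgl1 hgl2 hgl3 hl0 hl1 hl2 hl3 hl5 hH1 hIR hsym htr hadjL hfacts (fun x => geo9Y_dist_comm x) (const37_nonneg d hB₀.le hN hN' hCℓ hK)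
    hCB hCL hδ₁ hαF hαδ1 hCg har c35Y_pos ha₁ hα hα2 hNF hθ₀ hNH hδnn le_rfl hδ₀.le hNL hBL hNI hB5 hst hcntH hcntL hcntI hBl hθH hBI hBI2 hθI hBβ hBε hBεβ
    h261 hfacts₀
    (fun x hM α₀ hα₀ ha U hU => ⟨(h36 x hM α₀ hα₀ ha U hU).2.1, (h36 x hM α₀ hα₀ ha U hU).2.2, (h36H x hM α₀ hα₀ ha U hU).1, (h36H x hM α₀ hα₀ ha U hU).2.1⟩)
    (fun x hM α₀ hα₀ ha U hU => (h36H x hM α₀ hα₀ ha U hU).2.2.1) (fun x hM α₀ hα₀ ha U hU => (h36H x hM α₀ hα₀ ha U hU).2.2.2) hrest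

/-! ## `t37` at the all-blocks pin of `E37`, everything but the line (3.46)₄ proved (n06-k's G′ twin `B9RWSums344InputGp`) -/

/-- ★ **`t37` AT THE ALL-BLOCKS PIN, EVERYTHING BUT THE LINE (3.46)₄ PROVED** `(ops x).E37 = E37AllOfOps (W38OfOps (𝔬 x) (rd x) (R x) (H x) C δ) (𝔬 x) (R x) (H x) C δ (ops x).Gp B₁ δ₁ …`
(C = `const37 …`, δ = (1−2α)δ₀): n06-c's walk-pin inputs give Theorem 3.7 at `W38OfOps …` (`thm37Printed_W38OfOps_of_local342`), and n06-k's `thm37Printed_allPin_inputHolder` strengthens the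
predicate to all blocks from the co-readings of `(ops x).Gp` (sup ∕ weighted ∕ L² incl. `hl3 hl5` ∕ Hölder-through-probes `hH1` ∕ input `hIR` through the letter `bH`), the symmetry of G′(U), the
transpose pair and the transpose letter `hadjL`, `Facts347` (M ≧ M_g; at rate δ₀ for M ≧ M_F), Cor. 3.6's Hölder legs, the V-terms through the probes, the Laplacian legs, the input legs and the
input-read factors (`h36H`), the constants' relations (`hBβ`, `hB5`, `hBε`, `hBεβ`) and the residual (3.46)₄ under the provisos — displayed.
[cite: Balaban1985BackgroundPropagators, Thm 3.7 (3.87)–(3.90) pp.408–410, Thm 3.7 ⇒ Thm 3.1 p.410, Cor. 3.6 p.408, (3.40) p.397, (3.42)–(3.47) pp.397–398; Balaban1984PropagatorsII, Lemma 2.1 (2.60)–(2.61) p.234] -/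
theorem t37_of_allPin_input [∀ x : MemberY θ₃.d₆ θ₃.ℓ₆ θ₃.hd' θ₃.hL' θ₃.b₀ θ₃.b₁ Mstar, Fintype (geo9Y x).Site] [∀ x : MemberY θ₃.d₆ θ₃.ℓ₆ θ₃.hd' θ₃.hL' θ₃.b₀ θ₃.b₁ Mstar, DecidableEq (geo9Y x).Site]
    {X Y ι PX PY : MemberY θ₃.d₆ θ₃.ℓ₆ θ₃.hd' θ₃.hL' θ₃.b₀ θ₃.b₁ Mstar → Type} [∀ x, Fintype (X x)] [∀ x, DecidableEq (X x)] [∀ x, Fintype (Y x)] [∀ x, DecidableEq (Y x)]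
    [∀ x, Fintype (ι x)] [∀ x, Fintype (PX x)] [∀ x, DecidableEq (PX x)] [∀ x, Fintype (PY x)] [∀ x, DecidableEq (PY x)]
    (𝔬 : ∀ x, Ops (geo9Y x) (bg9Y (Matrix (Fin N) (Fin N) ℂ) (specialUnitaryUnits (Fin N)) x) (X x) (Y x) (ι x)) (rd : ∀ x, WalkReading (geo9Y x) (bg9Y (Matrix (Fin N) (Fin N) ℂ) (specialUnitaryUnits (Fin N)) x) (X x) (ι x))
    (𝔭 : ∀ x : MemberY θ₃.d₆ θ₃.ℓ₆ θ₃.hd' θ₃.hL' θ₃.b₀ θ₃.b₁ Mstar, HolderProbes (geo9Y x) (bg9Y (Matrix (Fin N) (Fin N) ℂ) (specialUnitaryUnits (Fin N)) x) (X x) (Y x) (PX x) (PY x))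
    (SH SL SI : ∀ x : MemberY θ₃.d₆ θ₃.ℓ₆ θ₃.hd' θ₃.hL' θ₃.b₀ θ₃.b₁ Mstar, ι x → Finset (geo9Y x).Site) (Bl BV BI θI : ℝ → ℝ) (BI2 : ℝ → ℝ → ℝ) (NH NL BL MF NI : ℝ) (dL : ℕ)
    (R : MemberY θ₃.d₆ θ₃.ℓ₆ θ₃.hd' θ₃.hL' θ₃.b₀ θ₃.b₁ Mstar → ℝ) (H : MemberY θ₃.d₆ θ₃.ℓ₆ θ₃.hd' θ₃.hL' θ₃.b₀ θ₃.b₁ Mstar → Prop) (κ : MemberY θ₃.d₆ θ₃.ℓ₆ θ₃.hd' θ₃.hL' θ₃.b₀ θ₃.b₁ Mstar → Sizes) (d : ℕ) (α ρ Nc N' Cℓ K θ₀ B₀ δ₀ a₁ M₁ ML : ℝ)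
    (bH : ∀ x : MemberY θ₃.d₆ θ₃.ℓ₆ θ₃.hd' θ₃.hL' θ₃.b₀ θ₃.b₁ Mstar, ℝ → BlockNorm (toB6 (geo9Y x) (R x) (H x)) (Y x → ℝ))
    (hα : 0 ≤ α) (hα2 : α ≤ 1 / 2) (hN : 0 ≤ Nc) (hN' : 0 ≤ N') (hCℓ : 1 ≤ Cℓ) (hK : 0 ≤ K) (hB₀ : 0 ≤ B₀) (hδ₀ : 0 ≤ δ₀) (ha₁ : 0 < a₁) (hM₁ : 0 < M₁)
    (hNH : 0 ≤ NH) (hNL : 0 ≤ NL) (hBL : 0 ≤ BL) (hNI : 0 ≤ NI)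
    (hst : ∀ x, StaticOK (𝔬 x) ρ Nc N' Cℓ (κ x)) (hκ : ∀ x, (κ x).Bounded K θ₀ Cℓ (geo9Y x).M)
    (h261 : ∀ x : MemberY θ₃.d₆ θ₃.ℓ₆ θ₃.hd' θ₃.hL' θ₃.b₀ θ₃.b₁ Mstar, ML ≤ (geo9Y x).M → Ineq261 d (toB6 (geo9Y x) (R x) (H x)) δ₀ α)
    (h36 : ∀ x : MemberY θ₃.d₆ θ₃.ℓ₆ θ₃.hd' θ₃.hL' θ₃.b₀ θ₃.b₁ Mstar, M₁ ≤ (geo9Y x).M → ∀ α₀ : ℝ, 0 < α₀ → c35Y * (geo9Y x).M * α₀ ≤ a₁ →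
      ∀ U : (bg9Y (Matrix (Fin N) (Fin N) ℂ) (specialUnitaryUnits (Fin N)) x).Cfg, (bg9Y (Matrix (Fin N) (Fin N) ℂ) (specialUnitaryUnits (Fin N)) x).Reg335 c35Y α₀ U → Local342 (𝔬 x) (R x) (H x) B₀ δ₀ U ∧ Identities (𝔬 x) (R x) (H x) U)
    (h36H : ∀ x : MemberY θ₃.d₆ θ₃.ℓ₆ θ₃.hd' θ₃.hL' θ₃.b₀ θ₃.b₁ Mstar, M₁ ≤ (geo9Y x).M → ∀ α₀ : ℝ, 0 < α₀ → c35Y * (geo9Y x).M * α₀ ≤ a₁ →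
      ∀ U : (bg9Y (Matrix (Fin N) (Fin N) ℂ) (specialUnitaryUnits (Fin N)) x).Cfg, (bg9Y (Matrix (Fin N) (Fin N) ℂ) (specialUnitaryUnits (Fin N)) x).Reg335 c35Y α₀ U →
        HolderLegs37 (𝔬 x) (𝔭 x) (R x) (H x) (SH x) Bl δ₀ U ∧ HolderV37 (𝔬 x) (𝔭 x) (R x) (H x) BV δ₀ U ∧ LapLegs37 (𝔬 x) (R x) (H x) (SL x) BL δ₀ U ∧
          InputLegs37 (𝔬 x) (𝔭 x) (R x) (H x) (bH x) (SI x) BI BI2 δ₀ U ∧ FactorsInput37 (𝔬 x) (R x) (H x) (bH x) θI δ₀ U)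
    (hcntH : ∀ (x : MemberY θ₃.d₆ θ₃.ℓ₆ θ₃.hd' θ₃.hL' θ₃.b₀ θ₃.b₁ Mstar) (a : (geo9Y x).Site), (∑ q, if a ∈ SH x q then (1 : ℝ) else 0) ≤ NH)
    (hcntL : ∀ (x : MemberY θ₃.d₆ θ₃.ℓ₆ θ₃.hd' θ₃.hL' θ₃.b₀ θ₃.b₁ Mstar) (a : (geo9Y x).Site), (∑ q, if a ∈ SL x q then (1 : ℝ) else 0) ≤ NL)
    (hcntI : ∀ (x : MemberY θ₃.d₆ θ₃.ℓ₆ θ₃.hd' θ₃.hL' θ₃.b₀ θ₃.b₁ Mstar) (a : (geo9Y x).Site), (∑ q, if a ∈ SI x q then (1 : ℝ) else 0) ≤ NI)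
    (hBl : ∀ β, 0 ≤ β → β < 1 → 0 ≤ Bl β) (hBV : ∀ β, 0 ≤ β → β < 1 → 0 ≤ BV β) (hBI : ∀ ε, 0 < ε → ε ≤ 1 → 0 ≤ BI ε)
    (hBI2 : ∀ ε β, 0 < ε → ε ≤ 1 → 0 ≤ β → β < 1 → 0 ≤ BI2 ε β) (hθI : ∀ ε, 0 < ε → 0 ≤ θI ε)
    (ev : ∀ x : MemberY θ₃.d₆ θ₃.ℓ₆ θ₃.hd' θ₃.hL' θ₃.b₀ θ₃.b₁ Mstar, (geo9Y x).Loc → X x → ℝ) (evY : ∀ x : MemberY θ₃.d₆ θ₃.ℓ₆ θ₃.hd' θ₃.hL' θ₃.b₀ θ₃.b₁ Mstar, (geo9Y x).Loc → Y x → ℝ)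
    (hco0 : ∀ x U, CoRealizes (ops x).Gp 0 U (𝔬 x).blk (𝔬 x).blk (ev x) ((𝔬 x).Gp U))
    (hco1 : ∀ x U, CoRealizes (ops x).Gp 1 U (𝔬 x).blkY (𝔬 x).blk (ev x) ((𝔬 x).D U ∘ₗ (𝔬 x).Gp U))
    (hco2 : ∀ x U, CoRealizes (ops x).Gp 2 U (𝔬 x).blk (𝔬 x).blkY (evY x) ((𝔬 x).Gp U ∘ₗ (𝔬 x).Dstar U))
    (hco3 : ∀ x U, CoRealizes (ops x).Gp 3 U (𝔬 x).blk (𝔬 x).blk (ev x) ((𝔬 x).Lap U ∘ₗ (𝔬 x).Gp U))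
    (hgl0 : ∀ x U, GlobReads (ops x).Gp 0 U (𝔬 x).blk (𝔬 x).blk (ev x) ((𝔬 x).Gp U))
    (hgl1 : ∀ x U, GlobReads (ops x).Gp 1 U (𝔬 x).blkY (𝔬 x).blk (ev x) ((𝔬 x).D U ∘ₗ (𝔬 x).Gp U))
    (hgl2 : ∀ x U, GlobReads (ops x).Gp 2 U (𝔬 x).blk (𝔬 x).blkY (evY x) ((𝔬 x).Gp U ∘ₗ (𝔬 x).Dstar U))
    (hgl3 : ∀ x U, GlobReads (ops x).Gp 3 U (𝔬 x).blk (𝔬 x).blk (ev x) ((𝔬 x).Lap U ∘ₗ (𝔬 x).Gp U))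
    (hl0 : ∀ x U, L2Reads (R := R x) (H := H x) (ops x).Gp 0 U (𝔬 x).blk (𝔬 x).blk (ev x) ((𝔬 x).Gp U))
    (hl1 : ∀ x U, L2Reads (R := R x) (H := H x) (ops x).Gp 1 U (𝔬 x).blkY (𝔬 x).blk (ev x) ((𝔬 x).D U ∘ₗ (𝔬 x).Gp U))
    (hl2 : ∀ x U, L2Reads (R := R x) (H := H x) (ops x).Gp 2 U (𝔬 x).blk (𝔬 x).blkY (evY x) ((𝔬 x).Gp U ∘ₗ (𝔬 x).Dstar U))
    (hl3 : ∀ x U, L2Reads (R := R x) (H := H x) (ops x).Gp 3 U (𝔬 x).blk (𝔬 x).blk (ev x) ((𝔬 x).Lap U ∘ₗ (𝔬 x).Gp U))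
    (hl5 : ∀ x U, L2Reads (R := R x) (H := H x) (ops x).Gp 5 U (𝔬 x).blk (𝔬 x).blk (ev x) ((𝔬 x).Gp U ∘ₗ (𝔬 x).Lap U))
    (hH1 : ∀ x U, H1Reads (ops x).Gp U (𝔭 x) (𝔬 x).blk (𝔬 x).blkY (ev x) (evY x) ((𝔬 x).D U ∘ₗ (𝔬 x).Gp U) ((𝔬 x).Gp U ∘ₗ (𝔬 x).Dstar U))
    (hIR : ∀ x U, InputReads (ops x).Gp U (𝔭 x) (bH x) (𝔬 x).blkY (evY x) ((𝔬 x).D U ∘ₗ ((𝔬 x).Gp U ∘ₗ (𝔬 x).Dstar U)))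
    (hsym : ∀ x U, IsTransposePair ((𝔬 x).Gp U) ((𝔬 x).Gp U))
    (htr : ∀ x U, IsTransposePair ((𝔬 x).D U ∘ₗ (𝔬 x).Gp U) ((𝔬 x).Gp U ∘ₗ (𝔬 x).Dstar U))
    (hadjL : ∀ x U, IsTransposePair ((𝔬 x).Lap U ∘ₗ (𝔬 x).Gp U) ((𝔬 x).Gp U ∘ₗ (𝔬 x).Lap U))
    {dF : ℕ} {αF L₀ B₁ δ₁ Mg Mr ar : ℝ} {Bβ Bε : ℝ → ℝ} {Bεβ : ℝ → ℝ → ℝ}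
    (hfacts : ∀ x : MemberY θ₃.d₆ θ₃.ℓ₆ θ₃.hd' θ₃.hL' θ₃.b₀ θ₃.b₁ Mstar, Mg ≤ (geo9Y x).M → Facts347 (geo9Y x) (R x) (H x) dF ((1 - 2 * α) * δ₀) αF L₀)
    (hCB : (const37 d δ₀ α ρ B₀ Nc N' Cℓ K) ≤ B₁) (hCL : (const37 d δ₀ α ρ B₀ Nc N' Cℓ K) * L₀ ≤ B₁) (hδ₁ : δ₁ ≤ (1 - αF) * ((1 - 2 * α) * δ₀)) (hαF : 0 ≤ αF * ((1 - 2 * α) * δ₀))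
    (hαF1 : αF ≤ 1)
    (hCg : (const37 d δ₀ α ρ B₀ Nc N' Cℓ K) * B6.c1 dF ((1 - 2 * α) * δ₀) (1 - αF) * L₀ ^ (4 : ℝ) ≤ B₁) (har : 0 < ar)
    (hBβ : ∀ β, 0 ≤ β → β < 1 → holderConst d δ₀ α NH N' (const37 d δ₀ α ρ B₀ Nc N' Cℓ K) (Bl β) (BV β) ≤ Bβ β)
    (hB5 : Real.sqrt ((const37 d δ₀ α ρ B₀ Nc N' Cℓ K) * lapConst d δ₀ α NL BL L₀) * L₀ ≤ B₁)
    (hfacts₀ : ∀ x : MemberY θ₃.d₆ θ₃.ℓ₆ θ₃.hd' θ₃.hL' θ₃.b₀ θ₃.b₁ Mstar, MF ≤ (geo9Y x).M → Facts347 (geo9Y x) (R x) (H x) dL δ₀ α L₀)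
    (hBε : ∀ ε, 0 < ε → ε ≤ 1 → inputConst44 d δ₀ α NI N' (const37 d δ₀ α ρ B₀ Nc N' Cℓ K) L₀ (BI ε) (θI ε) ≤ Bε ε)
    (hBεβ : ∀ ε β, 0 < ε → ε ≤ 1 → 0 ≤ β → β < 1 →
      inputConst45 d δ₀ α NI N' L₀ (holderConst d δ₀ α NH N' (const37 d δ₀ α ρ B₀ Nc N' Cℓ K) (Bl β) (BV β)) (BI2 ε β) (θI (β + ε)) ≤ Bεβ ε β)
    (hrest : ∀ x : MemberY θ₃.d₆ θ₃.ℓ₆ θ₃.hd' θ₃.hL' θ₃.b₀ θ₃.b₁ Mstar, Mr ≤ (geo9Y x).M → ∀ α₀ : ℝ, 0 < α₀ → (geo9Y x).M * α₀ ≤ ar → ∀ U : (bg9Y (Matrix (Fin N) (Fin N) ℂ) (specialUnitaryUnits (Fin N)) x).Cfg, (bg9Y (Matrix (Fin N) (Fin N) ℂ) (specialUnitaryUnits (Fin N)) x).Reg335 c35Y α₀ U →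
      ∀ (lam : (geo9Y x).Loc) (h : (geo9Y x).Cut) (y y' : (geo9Y x).Site), (geo9Y x).cutIn h y → (geo9Y x).suppIn lam y' →
        (ops x).Gp.l2 4 U lam h ≤ B₁ * B9.pref6 ((geo9Y x).len y) 4 * (geo9Y x).cutSup h * Real.exp (-(δ₁ * (geo9Y x).dist y y')) * (geo9Y x).l2Norm lam)
    (hE37 : ∀ x : MemberY θ₃.d₆ θ₃.ℓ₆ θ₃.hd' θ₃.hL' θ₃.b₀ θ₃.b₁ Mstar, (ops x).E37 = E37AllOfOps (W38OfOps (𝔬 x) (rd x) (R x) (H x) (const37 d δ₀ α ρ B₀ Nc N' Cℓ K) ((1 - 2 * α) * δ₀)) (𝔬 x) (R x) (H x) (const37 d δ₀ α ρ B₀ Nc N' Cℓ K) ((1 - 2 * α) * δ₀) (ops x).Gp B₁ δ₁ Bβ Bε Bεβ) :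
    B9.Thm37Printed c35Y geo9Y (bg9Y (Matrix (Fin N) (Fin N) ℂ) (specialUnitaryUnits (Fin N))) (fun x => (ops x).E37) := by
  have hfun : (fun x => (ops x).E37) = fun x => E37AllOfOps (W38OfOps (𝔬 x) (rd x) (R x) (H x) (const37 d δ₀ α ρ B₀ Nc N' Cℓ K) ((1 - 2 * α) * δ₀)) (𝔬 x) (R x) (H x) (const37 d δ₀ α ρ B₀ Nc N' Cℓ K) ((1 - 2 * α) * δ₀) (ops x).Gp B₁ δ₁ Bβ Bε Bεβ :=
    funext hE37
  rw [hfun]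
  have h37 := thm37Printed_W38OfOps_of_local342 𝔬 rd R H κ d α ρ Nc N' Cℓ K θ₀ B₀ δ₀ a₁ M₁ ML c35Y_pos hα hα2 hN hN' hCℓ hK hB₀ hδ₀ ha₁ hM₁ hst hκ h261 h36
  have hδnn : 0 ≤ (1 - 2 * α) * δ₀ := by nlinarith
  have hCℓ0 : (0 : ℝ) ≤ Cℓ := by linarith
  have hαδ1 : αF * ((1 - 2 * α) * δ₀) ≤ (1 - 2 * α) * δ₀ := by nlinarith
  exact thm37Printed_allPin_inputHolder (𝔴 := fun x => (W38OfOps (𝔬 x) (rd x) (R x) (H x) (const37 d δ₀ α ρ B₀ Nc N' Cℓ K) ((1 - 2 * α) * δ₀))) 𝔭 bH (fun x => (ops x).Gp) ev evY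
    κ SH Bl BV d δ₀ α ρ Nc N' Cℓ K θ₀ B₀ NH a₁ M₁ ML SL NL BL MF dL SI NI BI θI BI2 h37 hco0 hco1 hco2 hco3 hgl0 hgl1 hgl2 hgl3 hl0 hl1 hl2 hl3 hl5 hH1 hIR hsym htr
    hadjL hfacts (fun x => geo9Y_dist_comm x) (const37_nonneg d hB₀ hN hN' hCℓ hK) hCB hCL hδ₁ hαF hαδ1 hCg har c35Y_pos ha₁ hα hα2 hN' hCℓ0 hB₀ hNH hM₁ hδnn le_rfl
    hδ₀ hNL hBL hNI hB5 hst hκ hcntH hcntL hcntI hBl hBV hBI hBI2 hθI hBβ hBε hBεβ h261 hfacts₀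
    (fun x hM α₀ hα₀ ha U hU => ⟨(h36 x hM α₀ hα₀ ha U hU).1, (h36 x hM α₀ hα₀ ha U hU).2, (h36H x hM α₀ hα₀ ha U hU).1, (h36H x hM α₀ hα₀ ha U hU).2.1⟩)
    (fun x hM α₀ hα₀ ha U hU => (h36H x hM α₀ hα₀ ha U hU).2.2.1) (fun x hM α₀ hα₀ ha U hU => (h36H x hM α₀ hα₀ ha U hU).2.2.2) hrest

end Summit.QuantumFields.YangMills.BalabanUVNodes.N06AtRecord11ObligationsPins7

end
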